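import Mathlib
import HarnessLib
import Summits.AnomalousDissipation.AnomalousDissipation.Theses.ResponseTelescope
import Summits.AnomalousDissipation.AnomalousDissipation.Theorems.BaireTransferDenseLoudDesignerForcesErgodicModel
import Summits.AnomalousDissipation.AnomalousDissipation.Theorems.BaireTransferDenseLoudDesignerForcesStubBirkhoffMeans
import Summits.AnomalousDissipation.AnomalousDissipation.Theorems.BaireTransferDenseLoudDesignerForcesStubRecurrence

/-!
# Line `katok-closing` for the crux `ResponseTelescope.HalvingCeiling` (stmt-AnomalousDissipation-2028)

Crux-strategist r1 (redirect round), 2026-08-17.  This is the `--alt` line that the first strategy census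
(`Cruxes/HalvingCeiling/STRATEGY-CENSUS.md`, §Verdict, re-arm trigger 1) pre-announced under this name and
declined to register ONLY because "no linearised-NS / Floquet / Oseledets vocabulary exists in the library".
That premise was already false when it was written: the vocabulary had landed 24 h earlier, general in the
viscosity and in the force, in `Theorems/BaireTransferDenseLoudDesignerForcesErgodicLine.lean` (sibling crux
stmt-AnomalousDissipation-1143, line `ergodic-budget-selection-closing`): the phase space `Hsp = H`, NS phases
`IsNSPhase ν F K φ`, `IsInvariantMeasure`, the linearised equation `IsLinearizedNSSolutionOn`, Lyapunov growth
classes `SubExpGrowth` / `ExpDecay`, the trajectory means `energyAvg` / `dissipAvg`, with LANDED force-generic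
tools `stub_birkhoffMeans` (Birkhoff limits of the budgets exist a.e.), `stub_recurrence` (Poincaré recurrence at
integer times), `IsInvariantMeasure.enlarge`, and the Literature interfaces
`Literature.Dynamics.Hyperbolic.IsHyperbolicSemiflowModel` / `HasAmbientClosing` (Katok–Lian–Young closing for `C²`
local semiflows on a Hilbert space, the sibling's registered stub D).  The present file TRANSFERS that machinery to
this crux (lens `transfer`, at crux level) and repairs the one point where a verbatim transfer would be FALSE for
first-shell forces: continuous symmetry.

## The symmetry point (why this is not the sibling line with `F := f`)
A first-shell force is `f = g₁(x₁) + g₂(x₂) + g₃(x₃)` (single harmonics); whenever some `gⱼ = 0` — e.g. every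
Kolmogorov-type forcing, the best-studied turbulent case — `f` is invariant under the translations `x ↦ x + s eⱼ`.
Then along ANY trajectory `u` of `NS(f)` the field `∂ⱼu` solves the linearised equation with zero exponent, so the
classical hyperbolicity `IsHyperbolicMeasure` (no zero exponent except the flow direction) fails for every invariant
measure not carried by rigidly drifting states (Poincaré recurrence forces `∂ⱼu = a∂ₜu`): a response stub typed with
`IsHyperbolicMeasure` would be unattainable exactly in the flagship case.  The repair is classical equivariant
dynamics (method of slices; relative periodic orbits): hyperbolicity MODULO the symmetry generators
(`IsHyperbolicMeasureModSym`), closing up to a symmetry translation (`HasRelKatokClosing`: relative periodic points,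
shadowing modulo translations — budgets are translation invariant), and GALILEAN RE-PERIODISATION: a relative
periodic orbit `u(t+T) = u(t) ∘ τ_c` with drift `c` along the symmetry directions of `f` becomes, in the frame moving
with velocity `c/T` (a symmetry of the steadily forced problem precisely because `c` is a symmetry direction), a
genuinely `T`-periodic classical solution of `NS(f)` with mean momentum `c/T`, the same dissipation and energy
raised by `‖c‖²/T²` — which late returns (`T → ∞`) make as small as the tolerance requires; the crux allows
partners of any mean momentum.  For forces without continuous symmetry `symSpan f = {0}` and everything reduces to
the classical notions.

## Idea
Split the halving ceiling as RESPONSE (measure level) × RELATIVE CLOSING (Katok–Lian–Young modulo symmetry):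

* **R `stub_hyperbolicResponseMeasure` (load-bearing, hardest; physics).**  For every first-shell force `f` there
  are constants `(C, θ)` in the crux's clause such that every in-scope periodic orbit `u` of `NS_ν(f)` has, at the
  HALVED viscosity `ν/2`, an NS phase `(K, φ)` carrying an invariant probability measure `m`, hyperbolic modulo the
  translation symmetries of `f` (chaotic hypothesis, equivariant classical form), whose `m`-typical trajectories have
  time-average budgets STRICTLY inside the crux's tolerance window around `(Ē(u), Ī(u))`.  This is the crux with the
  periodic partner RELAXED to an invariant measure of strong solutions and hyperbolicity ADDED — the deliverable
  response theory speaks about (Ruelle 1997/2009, Hairer–Majda 2010, FMRT 2001 Ch. IV–V); the O(1)-response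
  difficulty recorded by census s1 (§0.4) is untouched and sits here, honestly.
* **N `stub_relSmoothModelOfPhase` (Navier–Stokes analysis + symmetry reduction; XL).**  A hyperbolic-mod-symmetry
  invariant measure of an NS phase admits an enlarged NS phase `(K', φ')` and a SLICED smooth model: a measurable
  phase-fixing map `π : H → H` intertwining `φ'` with a `C²` local semiflow `g` near a compact invariant `Λ`
  (`IsHyperbolicSemiflowModel U Λ g mm`, `mm = π_* m` strictly hyperbolic) such that closed `g`-orbits shadowing a
  projected phase orbit lift to RELATIVE periodic points of `φ'` in `K'` shadowing modulo symmetry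
  (`IsRelSmoothModelOf`).  For `symSpan F = {0}` this is the sibling's N read through `π = Smap⁻¹`.
* **D `stub_ambientClosing` (smooth ergodic theory on `H`; XXL, source-blocked).**  VERBATIM the sibling line's
  registered stub D: `IsHyperbolicSemiflowModel U Λ g m → HasAmbientClosing U Λ g m` (Katok 1980 Main Lemma;
  Lian–Young, JAMS 25 (2012); Barreira–Pesin 2023 Thm 11.10).  Whoever closes it closes it for both cruxes.
* **S `stub_relShadowBudgets` (M/L).**  Relative version of the sibling's landed Stub 4: shadowing modulo symmetry
  translations at integer times `≤ n` and `|T − n| ≤ η` give period means within `δ` (compactness of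
  `K × K × T³`, translation invariance of `‖·‖₂²` and `‖∇·‖₂²`, forward uniqueness of classical solutions).
* **W `stub_relPeriodicWitness` (M/L).**  Galilean re-periodisation: a relative periodic point of an NS phase with
  drift `c ∈ symSpan F` is carried by the boost of velocity `c/T` (landed dictionary `galilean_boost_general`,
  `boost_periodic`, `meanDissipation_boost`, `integral_norm_sq_boost`) to a `T`-periodic classical solution of
  `NS_ν(F)` on `ℝ × T³` with `meanEnergy = ‖c/T‖² + energyAvg φ z T`, `meanDissipation = dissipAvg ν φ z T`
  (for `c = 0`: the sibling's landed Stub 5, same proof).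
* **PROVED here (sorry-free):** `hasRelKatokClosing_of_relSmoothModel` (transport of the ambient closing through a
  sliced model — block G of the sibling, relative form), `energyAvg_congr_of_agree` / `dissipAvg_congr_of_agree`,
  `relClosingWithBudgetWindow` (TWO-SIDED relative closing with budgets and LATE closing times: a positive-measure
  budget cell meets a Pesin set; a typical point of the intersection has converging means and returns late and
  close; close the return modulo symmetry, transfer both budgets), and the composition `HalvingCeiling_of :
  R → N → D → S → W → HalvingCeiling` including the cell-exhaustion argument and the Galilean energy bookkeeping
  (`‖c‖ ≤ R`, `T ≥ 2(k+1)max(R,1)` ⇒ shift `≤ 1/(4(k+1))`, absorbed by shrinking the cell by `1/(k+1)` and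
  closing at precision `1/(4(k+1))`).

## Why it dodges what stopped `birth`
Census s1 (§D-0 (a),(b), §T-E (3),(4)) recorded two defects of `Lines/birth.lean` that make its closing stub
unprovable in kind: it must close at the budgets of ANY statistically steady classical trajectory (generic points
of NON-ergodic measures, quasi-periodic tori — the hull gap), and its response partner is not asked to be
`H¹`-bounded / to live on a compact invariant set.  Here compactness is in `IsNSPhase`, the hull gap is charged to
R (a.e. window = the measure is delivered "ergodic enough"), hyperbolicity is explicit and correctly equivariant,
and the closing half is print mathematics shared with the sibling programme (D verbatim; N = sibling N + slices).

## Disproof used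
None exists for this crux (no `Disproof.lean`, no `_false_without_` theorems, no landed Negative lemmas, no dead
lines) — `ledger crux ls stmt-AnomalousDissipation-2028`, `ledger negatives --problem AnomalousDissipation`
(6 entries, none about invariant measures / closing / hyperbolicity), 2026-08-17.
-/

set_option linter.dupNamespace false

noncomputable section

open scoped BigOperators Topology ENNReal InnerProductSpace
open Filter Set Function MeasureTheory

namespace Summit.AnomalousDissipation.AnomalousDissipation.Cruxes.HalvingCeiling.KatokClosing

open Literature.Analysis.FunctionSpaces Literature.Analysis.FunctionSpaces.Torus
open Literature.Analysis.FluidPDE Literature.Analysis.FluidPDE.Torus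
open Literature.Dynamics.Hyperbolic
open Summit.AnomalousDissipation.AnomalousDissipation.Theses.ResponseTelescope
open Summit.AnomalousDissipation.AnomalousDissipation.Theorems.DenseLoudDesignerForces.Ergodic

/-- The physical flat unit torus `T³` (local notation). -/
local notation "𝕋³" => UnitAddTorus (Fin 3)
/-- Velocity values (local notation). -/
local notation "E³" => EuclideanSpace ℝ (Fin 3)

/-! ### Vocabulary: symmetry directions, relative periodic points, equivariant hyperbolicity and closing -/

/-- The TRANSLATION-SYMMETRY DIRECTIONS of a steady force `F`: vectors `c` such that `F` is invariant under the
whole one-parameter group of translations `y ↦ y + [s c]`.  Always contains `0`; closed under scaling; for a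
first-shell force `g₁(x₁)+g₂(x₂)+g₃(x₃)` it is the coordinate subspace spanned by the `eⱼ` with `gⱼ = 0`
(e.g. `span {e₂, e₃}` for Kolmogorov forcing `(0, 0, sin 2πx₁)`), and `{0}` when no `gⱼ` vanishes. [folklore] -/
def symSpan (F : 𝕋³ → E³) : Set E³ :=
  {c | ∀ (s : ℝ) (y : 𝕋³), F (y + Torus.proj (s • c)) = F y}

/-- **Relative periodic point** of the NS_ν(F) semiflow `φ` with relative period `T` and drift `c`: every classical
trajectory `(u, p)` on `[0, ∞)` representing the orbit of `z` satisfies `u(s + T) = u(s) ∘ τ_c` for `s ≥ 0`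
(`τ_c y = y + [c]`).  For `c = 0` this is the periodicity of the representing trajectory that the sibling line
derives from `φ T z = z`. [cite: WillisCvitanovicAvila2013, §2 (relative periodic orbits)] -/
def IsRelPeriodicPt (ν : ℝ) (F : 𝕋³ → E³) (φ : ℝ → Hsp → Hsp) (z : Hsp) (T : ℝ) (c : E³) : Prop :=
  ∀ (u : ℝ → 𝕋³ → E³) (p : ℝ → 𝕋³ → ℝ), IsClassicalNSSolutionOn (Ici 0) ν (fun _ => F) u p →
    (∀ t : ℝ, 0 ≤ t → rep (φ t z) =ᵐ[volume] u t) →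
    ∀ s : ℝ, 0 ≤ s → ∀ y : 𝕋³, u (s + T) y = u s (y + Torus.proj c)

/-- **Hyperbolicity MODULO SYMMETRY of an invariant measure of the NS_ν(F) semiflow — the chaotic hypothesis in
equivariant classical form.**  As `IsHyperbolicMeasure`, except that from the initial value of a sub-exponentially
growing linearised solution one may subtract, besides a multiple of the flow direction `∂ₜu(0)`, a SYMMETRY
GENERATOR `(c·∇)u(0)` with `c ∈ symSpan F` (these are linearised solutions of zero exponent: derivatives of the
curves of solutions `s ↦ u ∘ τ_{sc}`).  At Lyapunov-regular points: no zero exponent except those of the flow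
direction and of the symmetry directions.  For `symSpan F = {0}` it is `IsHyperbolicMeasure`.
[cite: LianYoung2012, §1] [cite: WillisCvitanovicAvila2013, §2] -/
def IsHyperbolicMeasureModSym (ν : ℝ) (F : 𝕋³ → E³) (φ : ℝ → Hsp → Hsp) (μ : Measure Hsp) : Prop :=
  ∀ᵐ x ∂μ, ∀ (u : ℝ → 𝕋³ → E³) (p : ℝ → 𝕋³ → ℝ), IsClassicalNSSolutionOn (Ici 0) ν (fun _ => F) u p →
    (∀ t : ℝ, 0 ≤ t → rep (φ t x) =ᵐ[volume] u t) →
    ∀ (w : ℝ → 𝕋³ → E³) (q : ℝ → 𝕋³ → ℝ), IsLinearizedNSSolutionOn (Ici 0) ν u w q → SubExpGrowth w →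
      ∃ a : ℝ, ∃ c ∈ symSpan F, ∀ (w' : ℝ → 𝕋³ → E³) (q' : ℝ → 𝕋³ → ℝ),
        IsLinearizedNSSolutionOn (Ici 0) ν u w' q' →
        w' 0 = w 0 - a • Torus.timeDerivWithin (Ici 0) u 0 - convect (fun _ => c) (u 0) → ExpDecay w'

/-- **Relative Katok closing along Pesin sets (OUTPUT SHAPE of the equivariant closing lemma for `φ` on `K`).**
Measurable `Λ_ℓ ⊆ K` exhaust `μ`-almost everything; for every `ℓ` and `η > 0` there is `δ > 0` such that
whenever `x ∈ Λ_ℓ` returns at an integer time `n ≥ 1` to `Λ_ℓ` within `δ` of itself, some `z ∈ K` is a RELATIVE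
periodic point with relative period `T`, `|T − n| ≤ η`, drift `c ∈ symSpan F` with `‖c‖ ≤ R` for ONE constant
`R` (drifts matter only through `[c] ∈ T³`, so they can be reduced modulo the lattice `symSpan F ∩ ℤ³`, which is
cocompact in the rational subspace `symSpan F`; `R` = its covering radius, `≤ √3/2` for first-shell forces), and
its orbit shadows that of `x` at the integer times `k ≤ n` MODULO symmetry translations in `L²`:
`‖φ_k z − (φ_k x) ∘ τ_e‖₂ ≤ η` for some `e ∈ symSpan F`.  For `symSpan F = {0}` this is `HasKatokClosing` with the
fixed-point clause read at trajectory level. [cite: BarreiraPesin2023, Thm 11.10] [cite: LianYoung2012, §1] -/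
def HasRelKatokClosing (ν : ℝ) (F : 𝕋³ → E³) (K : Set Hsp) (φ : ℝ → Hsp → Hsp) (μ : Measure Hsp) : Prop :=
  ∃ R : ℝ, ∃ Λ : ℕ → Set Hsp, (∀ ℓ, MeasurableSet (Λ ℓ)) ∧ (∀ ℓ, Λ ℓ ⊆ K) ∧ μ (⋃ ℓ, Λ ℓ)ᶜ = 0 ∧
    ∀ ℓ : ℕ, ∀ η : ℝ, 0 < η → ∃ δ : ℝ, 0 < δ ∧
      ∀ x ∈ Λ ℓ, ∀ n : ℕ, 0 < n → φ n x ∈ Λ ℓ → dist (φ n x) x < δ →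
        ∃ z ∈ K, ∃ T : ℝ, ∃ c ∈ symSpan F, 0 < T ∧ |T - n| ≤ η ∧ ‖c‖ ≤ R ∧ IsRelPeriodicPt ν F φ z T c ∧
          ∀ k : ℕ, k ≤ n → ∃ e ∈ symSpan F,
            ∫ y, ‖rep (φ k z) y - rep (φ k x) (y + Torus.proj e)‖ ^ 2 ≤ η ^ 2

/-- **Sliced smooth model of the phase `(K', φ')` carrying `μ` (interface; relative form of the sibling's
`IsSmoothModelOf`).**  `π : H → H` is a measurable phase-fixing map (method of slices: translate each state along
`symSpan F` to a reference phase, then smooth) carrying `K'` into the model set `Λ` and `μ` to the model measure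
`m`, uniformly continuous on `K'`, intertwining `φ'` with the model semiflow `g` at non-negative times; and — the
LIFTING GUARANTEE — a closed `g`-orbit through `U` whose orbit `η`-shadows the projected orbit of `x ∈ K'` at the
integer times `k ≤ n` lifts to a relative periodic point `z' ∈ K'` of `φ'` with the same relative period, a reduced
drift `c ∈ symSpan F`, `‖c‖ ≤ R` (one constant `R`), whose orbit `ε`-shadows that of `x` modulo symmetry, with
`η = η(ε)` uniform.
(The analytic content — `(U, Λ, g, m)` is an `IsHyperbolicSemiflowModel` — is a separate conjunct of stub N, not
used by the transport theorem below.) [cite: WillisCvitanovicAvila2013, §2–3 (method of slices)] [folklore] -/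
structure IsRelSmoothModelOf (ν : ℝ) (F : 𝕋³ → E³) (K' : Set Hsp) (φ' : ℝ → Hsp → Hsp) (μ : Measure Hsp)
    (π : Hsp → Hsp) (U Λ : Set Hsp) (g : ℝ → Hsp → Hsp) (m : Measure Hsp) : Prop where
  /-- The phase-fixing map is measurable. -/
  measurable : Measurable π
  /-- It carries `μ` to the model measure. -/
  map_eq : Measure.map π μ = m
  /-- It carries the phase into the model set. -/
  mapsTo : MapsTo π K' Λ
  /-- It is uniformly continuous on the phase. -/
  unif : ∀ δ : ℝ, 0 < δ → ∃ δ' : ℝ, 0 < δ' ∧ ∀ a ∈ K', ∀ b ∈ K', dist a b < δ' → dist (π a) (π b) < δ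
  /-- It intertwines the semiflows at non-negative times. -/
  conj : ∀ t : ℝ, 0 ≤ t → ∀ x ∈ K', π (φ' t x) = g t (π x)
  /-- Lifting guarantee: shadowing closed model orbits lift to shadowing relative periodic points in `K'`. -/
  lift : ∃ R : ℝ, ∀ ε : ℝ, 0 < ε → ∃ η : ℝ, 0 < η ∧ ∀ x ∈ K', ∀ n : ℕ, ∀ z ∈ U, ∀ T : ℝ, 0 < T →
    (∀ t ∈ Icc 0 T, g t z ∈ U) → g T z = z → (∀ k : ℕ, k ≤ n → dist (g k z) (g k (π x)) ≤ η) →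
    ∃ z' ∈ K', ∃ c ∈ symSpan F, ‖c‖ ≤ R ∧ IsRelPeriodicPt ν F φ' z' T c ∧
      ∀ k : ℕ, k ≤ n → ∃ e ∈ symSpan F,
        ∫ y, ‖rep (φ' k z') y - rep (φ' k x) (y + Torus.proj e)‖ ^ 2 ≤ ε ^ 2

/-! ### Stub signatures (`Sig.stub_*`; the hypothesis heads of `HalvingCeiling_of`) -/

/-- STUB R — HYPERBOLIC-MOD-SYMMETRY RESPONSE MEASURE ACROSS ONE VISCOSITY HALVING (load-bearing, hardest;
physics).  For every first-shell force `f` there are `C ≥ 0`, `θ ∈ (0,1]` in the crux's clause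
`C(1/250)^θ ≤ (1−(3/4)^θ)/10` such that every in-scope periodic orbit `u` of `NS_ν(f)` (`Ē > 0`, `β ≥ 1/20`,
`r ≤ 1/250`) admits at viscosity `ν/2` an NS phase `(K, φ)` of the same force with an invariant probability
measure `m`, hyperbolic modulo the translation symmetries of `f` (`IsHyperbolicMeasureModSym`), such that for
`m`-a.e. `x` the limits `(e, d)` of the running means `energyAvg φ x`, `dissipAvg (ν/2) φ x` (they exist a.e.,
`stub_birkhoffMeans`) lie STRICTLY inside the window `|e − Ē| < Cρ^{θ/2}Ē`, `|d − Ī| < Cρ^{θ/2}Ī`, `ρ = νĪ/Ē²`.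
[cite: Ruelle2009 doi:10.1088/0951-7715/22/4/009] [cite: FMRTTurbulence2001, Ch. IV §2, Ch. V §1]
[cite: GallavottiCohen1995 doi:10.1103/PhysRevLett.74.2694] -/
def Sig.stub_hyperbolicResponseMeasure : Prop :=
  ∀ f : 𝕋³ → E³, IsSmooth f → IsDivFree f → HasZeroMean f →
    (∀ x, laplacian f x = -((4 * Real.pi ^ 2) • f x)) →
    ∃ C θ : ℝ, 0 ≤ C ∧ 0 < θ ∧ θ ≤ 1 ∧
      C * (1 / 250 : ℝ) ^ θ ≤ (1 - (3 / 4 : ℝ) ^ θ) / 10 ∧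
      ∀ (ν τ : ℝ) (u : ℝ → 𝕋³ → E³) (p : ℝ → 𝕋³ → ℝ), 0 < ν → 0 < τ → Periodic u τ →
        IsClassicalNSSolutionOn univ ν (fun _ => f) u p →
        0 < meanEnergy u →
        (1 / 20 : ℝ) * (meanEnergy u * Real.sqrt (meanEnergy u)) ≤ meanDissipation ν u →
        ν * meanDissipation ν u ≤ (1 / 250 : ℝ) ^ 2 * meanEnergy u ^ 2 →
        ∃ (K : Set Hsp) (φ : ℝ → Hsp → Hsp) (m : Measure Hsp),
          IsNSPhase (ν / 2) f K φ ∧ IsInvariantMeasure K φ m ∧ IsHyperbolicMeasureModSym (ν / 2) f φ m ∧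
          ∀ᵐ x ∂m, ∀ e d : ℝ, Tendsto (energyAvg φ x) atTop (𝓝 e) →
            Tendsto (dissipAvg (ν / 2) φ x) atTop (𝓝 d) →
            |e - meanEnergy u| <
                C * (ν * meanDissipation ν u / meanEnergy u ^ 2) ^ (θ / 2) * meanEnergy u ∧
            |d - meanDissipation ν u| <
                C * (ν * meanDissipation ν u / meanEnergy u ^ 2) ^ (θ / 2) * meanDissipation ν u

/-- STUB N — SLICED SMOOTH HYPERBOLIC MODEL OF AN ENLARGED NS PHASE (Navier–Stokes analysis + symmetry reduction;
XL).  A hyperbolic-mod-symmetry invariant probability measure `m` of an NS phase `(K, φ)` of NS_μ′ forced by a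
smooth, divergence-free, mean-free steady `F` admits an enlarged NS phase `(K', φ')` of the same force (`K ⊆ K'`,
`φ' = φ` on `[0,∞) × K`) together with a sliced smooth model `(π, U, Λ, g, mm)`: `IsHyperbolicSemiflowModel U Λ g mm`
and `IsRelSmoothModelOf μ′ F K' φ' m π U Λ g mm`.  Intended construction: the sibling's block N (strong-solution
map read through `(1 + A)⁻¹`, compact injective derivatives by parabolic smoothing and backward uniqueness, phase
enlargement by `H¹`-bounded global strong solutions) composed with a slice (phase of a non-vanishing Fourier mode
along each direction of `symSpan F`, charts switched where it degenerates); for `symSpan F = {0}` no slicing.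
[cite: Temam1997, Ch. VII §2.1] [cite: ConstantinFoiasNSE1988, Ch. 12–14] [cite: RobinsonRodrigoSadowski2016,
Thm 6.8, 9.1] [cite: WillisCvitanovicAvila2013, §3] [cite: BudanurEtAl2015 arXiv:1405.1096] -/
def Sig.stub_relSmoothModelOfPhase : Prop :=
  ∀ (μ' : ℝ) (F : 𝕋³ → E³) (K : Set Hsp) (φ : ℝ → Hsp → Hsp) (m : Measure Hsp),
    0 < μ' → IsSmooth F → IsDivFree F → HasZeroMean F →
    IsNSPhase μ' F K φ → IsInvariantMeasure K φ m → IsHyperbolicMeasureModSym μ' F φ m →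
    ∃ (K' : Set Hsp) (φ' : ℝ → Hsp → Hsp) (π : Hsp → Hsp) (U Λ : Set Hsp) (g : ℝ → Hsp → Hsp)
      (mm : Measure Hsp),
      K ⊆ K' ∧ (∀ t : ℝ, 0 ≤ t → ∀ x ∈ K, φ' t x = φ t x) ∧ IsNSPhase μ' F K' φ' ∧
        IsHyperbolicSemiflowModel U Λ g mm ∧ IsRelSmoothModelOf μ' F K' φ' m π U Λ g mm

/-- STUB D — THE CLOSING LEMMA FOR HYPERBOLIC MEASURES OF `C²` LOCAL SEMIFLOWS ON `H` (smooth ergodic theory;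
XXL, source-blocked: LianYoung2012 acq-01690/05574, LianYoung2011 acq-05212, Ruelle1982 acq-06170, Mañé1983
acq-06171, LianLu2010 acq-06172 unheld).  VERBATIM the sibling line's registered stub D (crux 1143, line
`ergodic-budget-selection-closing`): `IsHyperbolicSemiflowModel U Λ g m → HasAmbientClosing U Λ g m` over `Hsp`.
[cite: LianYoung2012, §1 and the closing lemma] [cite: BarreiraPesin2023, Thm 4.10, 4.13, 11.10]
[cite: Katok1980 doi:10.1007/bf02684777, Main Lemma] -/
def Sig.stub_ambientClosing : Prop :=
  ∀ (U Λ : Set Hsp) (g : ℝ → Hsp → Hsp) (mm : Measure Hsp),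
    IsHyperbolicSemiflowModel U Λ g mm → HasAmbientClosing U Λ g mm

/-- STUB S — RELATIVE SHADOWING TRANSFERS BUDGETS (M/L; relative form of the sibling's landed Stub 4
`stub_shadowBudgets`).  For an NS phase `(K, φ)` of NS_ν(F) and `δ > 0` there is `η > 0` such that if the orbit of
`z ∈ K` shadows that of `x ∈ K` at the integer times `k ≤ n` modulo symmetry translations in `L²` within `η`, and
`|T − n| ≤ η`, then the energy and dissipation means of `z` over `[0, T]` are within `δ` of those of `x` over
`[0, n]` (compactness of `K × K × T³`, strong continuity of translations on `L²`, translation invariance of `‖·‖₂²`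
and `‖∇·‖₂²`, forward uniqueness and continuity of classical solutions with bounded enstrophy over unit times).
[cite: RobinsonRodrigoSadowski2016, Thm 6.10 (L² stability from H¹ control)] [folklore] -/
def Sig.stub_relShadowBudgets : Prop :=
  ∀ (ν : ℝ) (F : 𝕋³ → E³) (K : Set Hsp) (φ : ℝ → Hsp → Hsp),
    0 < ν → IsSmooth F → IsDivFree F → HasZeroMean F → IsNSPhase ν F K φ →
    ∀ δ : ℝ, 0 < δ → ∃ η : ℝ, 0 < η ∧ ∀ x ∈ K, ∀ z ∈ K, ∀ n : ℕ, 0 < n → ∀ T : ℝ, |T - n| ≤ η →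
      (∀ k : ℕ, k ≤ n → ∃ e ∈ symSpan F,
        ∫ y, ‖rep (φ k z) y - rep (φ k x) (y + Torus.proj e)‖ ^ 2 ≤ η ^ 2) →
      |energyAvg φ z T - energyAvg φ x n| ≤ δ ∧ |dissipAvg ν φ z T - dissipAvg ν φ x n| ≤ δ

/-- STUB W — GALILEAN RE-PERIODISATION OF A RELATIVE PERIODIC POINT (M/L; for `c = 0` the sibling's landed Stub 5
`stub_classicalPeriodicWitness` with a general steady force).  A relative periodic point `z ∈ K` of an NS phase of
NS_ν(F), relative period `T > 0`, drift `c ∈ symSpan F`, yields a classical solution `(u, p)` of NS_ν forced by `F` on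
all of `ℝ × T³`, `T`-periodic in time, with `meanEnergy u = ‖c/T‖² + energyAvg φ z T` and
`meanDissipation ν u = dissipAvg ν φ z T`: boost the representing trajectory by the velocity `c/T` (a symmetry of the
steadily forced problem since `c ∈ symSpan F`; landed `galilean_boost_general`, `boost_periodic`,
`integral_norm_sq_boost`, `meanDissipation_boost`), periodise in time, read the period means.
[cite: WillisCvitanovicAvila2013, §2 (relative periodic orbits are periodic in a co-moving frame)] [folklore] -/
def Sig.stub_relPeriodicWitness : Prop :=
  ∀ (ν : ℝ) (F : 𝕋³ → E³) (K : Set Hsp) (φ : ℝ → Hsp → Hsp) (z : Hsp) (T : ℝ) (c : E³),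
    0 < ν → IsSmooth F → IsDivFree F → HasZeroMean F → IsNSPhase ν F K φ → z ∈ K → 0 < T →
    c ∈ symSpan F → IsRelPeriodicPt ν F φ z T c →
    ∃ (u : ℝ → 𝕋³ → E³) (p : ℝ → 𝕋³ → ℝ), IsClassicalNSSolutionOn univ ν (fun _ => F) u p ∧
      Function.Periodic u T ∧ meanEnergy u = ‖T⁻¹ • c‖ ^ 2 + energyAvg φ z T ∧
      meanDissipation ν u = dissipAvg ν φ z T

/-! ### Registered stubs -/

/-- Registered stub R — hyperbolic-mod-symmetry response measure across one halving (load-bearing, hardest; open: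
the finite-Reynolds response of the turbulent state of `NS(f)` to halving the viscosity, in measure form, with the
equivariant chaotic hypothesis). -/
theorem stub_hyperbolicResponseMeasure : Sig.stub_hyperbolicResponseMeasure := by
  sorry

/-- Registered stub N — sliced smooth hyperbolic model of an enlarged NS phase (print mathematics + slices). -/
theorem stub_relSmoothModelOfPhase : Sig.stub_relSmoothModelOfPhase := by
  sorry

/-- Registered stub D — ambient Katok closing for hyperbolic measures of `C²` local semiflows on `H` (print
mathematics; verbatim the sibling line's registered D). -/
theorem stub_ambientClosing : Sig.stub_ambientClosing := by
  sorry

/-- Registered stub S — relative shadowing transfers budgets. -/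
theorem stub_relShadowBudgets : Sig.stub_relShadowBudgets := by
  sorry

/-- Registered stub W — Galilean re-periodisation of a relative periodic point. -/
theorem stub_relPeriodicWitness : Sig.stub_relPeriodicWitness := by
  sorry

/-! ### Glue, part 1: transport of the ambient closing lemma through a sliced model -/

/-- **Block G, relative form — transport of the closing lemma through a sliced smooth model** (sorry-free).  If
`(π, U, Λ, g, m)` is a sliced smooth model of the phase `(K', φ')` carrying the invariant measure `μ`, and the model
semiflow has the ambient Katok closing property (`HasAmbientClosing`), then `μ` has the RELATIVE Katok closing
property in `(K', φ')`: Pesin sets `K' ∩ π⁻¹(P_ℓ)`; a return of `x` within the radius given by the uniform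
continuity of `π` is a return of `π x` in `P_ℓ`; close it in the model with accuracy `min η(ε) ε` and lift.
[folklore] -/
theorem hasRelKatokClosing_of_relSmoothModel {ν : ℝ} {F : 𝕋³ → E³} {K' : Set Hsp} {φ' : ℝ → Hsp → Hsp}
    {μ : Measure Hsp} {π : Hsp → Hsp} {U Λ : Set Hsp} {g : ℝ → Hsp → Hsp} {m : Measure Hsp}
    (hKc : IsCompact K') (hμ : IsInvariantMeasure K' φ' μ) (hS : IsRelSmoothModelOf ν F K' φ' μ π U Λ g m)
    (hcl : HasAmbientClosing U Λ g m) : HasRelKatokClosing ν F K' φ' μ := by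
  obtain ⟨P, hPc, hPΛ, hPnull, hclose⟩ := hcl
  obtain ⟨R, hliftR⟩ := hS.lift
  have hPm : ∀ ℓ, MeasurableSet (P ℓ) := fun ℓ => (hPc ℓ).isClosed.measurableSet
  have hK'm : MeasurableSet K' := hKc.isClosed.measurableSet
  refine ⟨R, fun ℓ => K' ∩ π ⁻¹' P ℓ, fun ℓ => hK'm.inter (hS.measurable (hPm ℓ)),
    fun ℓ => inter_subset_left, ?_, ?_⟩
  · -- the lifted Pesin sets exhaust `μ`-almost everything
    have h1 : μ (π ⁻¹' ⋃ ℓ, P ℓ)ᶜ = 0 := by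
      rw [← preimage_compl, ← Measure.map_apply hS.measurable (MeasurableSet.iUnion hPm).compl, hS.map_eq]
      exact hPnull
    refine measure_mono_null (fun y hy => ?_) (measure_union_null hμ.null_compl h1)
    by_cases hyK : y ∈ K'
    · right
      simp only [mem_compl_iff, mem_preimage, mem_iUnion, mem_inter_iff, not_exists, not_and] at hy ⊢
      exact fun ℓ hℓ => hy ℓ hyK hℓ
    · exact Or.inl hyK
  · intro ℓ η hη
    obtain ⟨η₁, hη₁, hlift⟩ := hliftR η hη
    obtain ⟨δ, hδ, hret⟩ := hclose ℓ (min η₁ η) (lt_min hη₁ hη)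
    obtain ⟨δ', hδ', hsep⟩ := hS.unif δ hδ
    refine ⟨δ', hδ', ?_⟩
    rintro x ⟨hxK, hxP⟩ n hn ⟨hnK, hnP⟩ hdist
    have hconj : ∀ k : ℕ, π (φ' k x) = g k (π x) := fun k => hS.conj k (Nat.cast_nonneg k) x hxK
    have hback : g n (π x) ∈ P ℓ := by rw [← hconj n]; exact hnP
    have hd : dist (g n (π x)) (π x) < δ := by rw [← hconj n]; exact hsep _ hnK _ hxK hdist
    obtain ⟨z, hzU, T, hT, hTn, horb, hfix, hshadow⟩ := hret (π x) hxP n hn hback hd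
    obtain ⟨z', hz'K, c, hc, hc1, hrel, hsh⟩ := hlift x hxK n z hzU T hT horb hfix
      fun k hk => (hshadow k hk).trans (min_le_left _ _)
    exact ⟨z', hz'K, T, c, hc, hT, hTn.trans (min_le_right _ _), hc1, hrel, hsh⟩

/-! ### Glue, part 2: enlarging the phase does not move trajectory means -/

/-- On `K`, where `φ'` agrees with `φ` at non-negative times, the running energy means agree at every `T ≥ 0`.
[folklore] -/
theorem energyAvg_congr_of_agree {K : Set Hsp} {φ φ' : ℝ → Hsp → Hsp}
    (hagree : ∀ t : ℝ, 0 ≤ t → ∀ x ∈ K, φ' t x = φ t x) {x : Hsp} (hx : x ∈ K) {T : ℝ} (hT : 0 ≤ T) :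
    energyAvg φ' x T = energyAvg φ x T := by
  unfold energyAvg
  congr 1
  refine intervalIntegral.integral_congr fun t ht => ?_
  rw [uIcc_of_le hT] at ht
  simp only [hagree t ht.1 x hx]

/-- On `K`, where `φ'` agrees with `φ` at non-negative times, the running dissipation means agree at every
`T ≥ 0`. [folklore] -/
theorem dissipAvg_congr_of_agree {K : Set Hsp} {φ φ' : ℝ → Hsp → Hsp}
    (hagree : ∀ t : ℝ, 0 ≤ t → ∀ x ∈ K, φ' t x = φ t x) {x : Hsp} (hx : x ∈ K) {ν : ℝ} {T : ℝ}
    (hT : 0 ≤ T) : dissipAvg ν φ' x T = dissipAvg ν φ x T := by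
  unfold dissipAvg
  congr 1
  refine intervalIntegral.integral_congr fun t ht => ?_
  rw [uIcc_of_le hT] at ht
  simp only [hagree t ht.1 x hx]

/-! ### Glue, part 3: two-sided relative closing with budgets and late closing times -/

/-- **TWO-SIDED RELATIVE CLOSING WITH BUDGETS** (sorry-free over the landed `stub_recurrence`, the relative
shadow-budget transfer `hS` (stub S instantiated) and the relative Katok closing property): if a measurable cell `B`
of positive measure has its Birkhoff budget limits within `(a, b)` of `(e₀, d₀)`, then for every `δ > 0` and every
`T₀` some relative periodic point `z ∈ K` — relative period `T ≥ T₀`, drift `c ∈ symSpan F` bounded by the closing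
constant `R` — has period means within `(a + δ, b + δ)` of `(e₀, d₀)`.  A Pesin set meets `B` in positive measure; a typical point of the
intersection has converging time means and returns arbitrarily LATE and close; close the return modulo symmetry
with accuracy `min η 1` and transfer both budgets. [folklore] -/
theorem relClosingWithBudgetWindow {ν : ℝ} {F : 𝕋³ → E³} {K : Set Hsp} {φ : ℝ → Hsp → Hsp} {μ : Measure Hsp}
    {En D : Hsp → ℝ} {e₀ d₀ a b : ℝ} {B : Set Hsp} (hK : IsNSPhase ν F K φ)
    (hμ : IsInvariantMeasure K φ μ) (hcl : HasRelKatokClosing ν F K φ μ)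
    (hS : ∀ δ : ℝ, 0 < δ → ∃ η : ℝ, 0 < η ∧ ∀ x ∈ K, ∀ z ∈ K, ∀ n : ℕ, 0 < n → ∀ T : ℝ, |T - n| ≤ η →
      (∀ k : ℕ, k ≤ n → ∃ e ∈ symSpan F,
        ∫ y, ‖rep (φ k z) y - rep (φ k x) (y + Torus.proj e)‖ ^ 2 ≤ η ^ 2) →
      |energyAvg φ z T - energyAvg φ x n| ≤ δ ∧ |dissipAvg ν φ z T - dissipAvg ν φ x n| ≤ δ)
    (hB : MeasurableSet B) (hμB : μ B ≠ 0)
    (hbud : ∀ x ∈ B, |En x - e₀| ≤ a ∧ |D x - d₀| ≤ b)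
    (hlim : ∀ᵐ x ∂μ, Tendsto (energyAvg φ x) atTop (𝓝 (En x)) ∧
      Tendsto (dissipAvg ν φ x) atTop (𝓝 (D x)))
    :
    ∃ R : ℝ, ∀ δ : ℝ, 0 < δ → ∀ T₀ : ℝ,
      ∃ z ∈ K, ∃ T : ℝ, ∃ c ∈ symSpan F, 0 < T ∧ T₀ ≤ T ∧ ‖c‖ ≤ R ∧ IsRelPeriodicPt ν F φ z T c ∧
        |energyAvg φ z T - e₀| ≤ a + δ ∧ |dissipAvg ν φ z T - d₀| ≤ b + δ := by
  obtain ⟨R, Λ, hΛm, hΛK, hΛμ, hclose⟩ := hcl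
  refine ⟨R, fun δ hδ T₀ => ?_⟩
  -- a Pesin set meeting `B` in positive measure
  obtain ⟨ℓ, hℓ⟩ : ∃ ℓ, μ (B ∩ Λ ℓ) ≠ 0 := by
    by_contra h
    push Not at h
    have h1 : μ (B ∩ ⋃ ℓ, Λ ℓ) = 0 := by
      rw [Set.inter_iUnion]; exact measure_iUnion_null h
    have h2 : μ B ≤ μ (B ∩ ⋃ ℓ, Λ ℓ) + μ (⋃ ℓ, Λ ℓ)ᶜ := by
      refine (measure_mono fun x hx => ?_).trans (measure_union_le _ _)
      by_cases h' : x ∈ ⋃ ℓ, Λ ℓ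
      exacts [Or.inl ⟨hx, h'⟩, Or.inr h']
    rw [h1, hΛμ, add_zero] at h2
    exact hμB (le_zero_iff.1 h2)
  -- shadowing accuracy `η` for budgets within `δ/2`, closing radius `δ'` for `(ℓ, min η 1)`
  obtain ⟨η, hη, hshadow⟩ := hS (δ / 2) (half_pos hδ)
  have hη1 : 0 < min η 1 := lt_min hη one_pos
  obtain ⟨δ', hδ', hret⟩ := hclose ℓ (min η 1) hη1
  -- a recurrent point of `B ∩ Λ ℓ` with converging time means
  have hrec := stub_recurrence hK hμ (hB.inter (hΛm ℓ)) hδ'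
  obtain ⟨x, ⟨hxB, hxΛ⟩, hxlim, hxfreq⟩ : ∃ x ∈ B ∩ Λ ℓ,
      (Tendsto (energyAvg φ x) atTop (𝓝 (En x)) ∧ Tendsto (dissipAvg ν φ x) atTop (𝓝 (D x))) ∧
      ∃ᶠ n : ℕ in atTop, φ n x ∈ B ∩ Λ ℓ ∧ dist (φ n x) x < δ' := by
    obtain ⟨x, hx, h⟩ :=
      Measure.exists_mem_of_measure_ne_zero_of_ae hℓ (ae_restrict_of_ae (hlim.and hrec))
    exact ⟨x, hx, h.1, h.2 hx⟩
  -- LATE return times have time means within `δ/2` of their limits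
  have hnat₁ := hxlim.1.comp tendsto_natCast_atTop_atTop
  have hnat₂ := hxlim.2.comp tendsto_natCast_atTop_atTop
  have hev : ∀ᶠ n : ℕ in atTop, dist (energyAvg φ x n) (En x) < δ / 2 ∧
      dist (dissipAvg ν φ x n) (D x) < δ / 2 ∧ 0 < n ∧ ⌈T₀⌉₊ + 1 ≤ n :=
    ((Metric.tendsto_nhds.1 hnat₁ _ (half_pos hδ)).and
      ((Metric.tendsto_nhds.1 hnat₂ _ (half_pos hδ)).and
        ((eventually_gt_atTop 0).and (eventually_ge_atTop _))))
  obtain ⟨n, ⟨hn₁, hn₂, hn0, hnN⟩, ⟨-, hnΛ⟩, hndist⟩ := (hev.and_frequently hxfreq).exists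
  -- close the return modulo symmetry and transfer the budgets
  obtain ⟨z, hzK, T, c, hc, hT, hTn, hc1, hrel, hsh⟩ := hret x hxΛ n hn0 hnΛ hndist
  have hηle : min η 1 ≤ η := min_le_left _ _
  obtain ⟨hE, hD⟩ := hshadow x (hΛK ℓ hxΛ) z hzK n hn0 T (hTn.trans hηle) fun k hk => by
    obtain ⟨e, he, hint⟩ := hsh k hk
    exact ⟨e, he, hint.trans (pow_le_pow_left₀ hη1.le hηle 2)⟩
  obtain ⟨hxE, hxD⟩ := hbud x hxB
  rw [Real.dist_eq] at hn₁ hn₂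
  have hT₀T : T₀ ≤ T := by
    have h1 := abs_le.1 (hTn.trans (min_le_right _ _))
    have h2 : ((⌈T₀⌉₊ : ℕ) : ℝ) + 1 ≤ n := by exact_mod_cast hnN
    have h3 : T₀ ≤ ((⌈T₀⌉₊ : ℕ) : ℝ) := Nat.le_ceil T₀
    linarith
  refine ⟨z, hzK, T, c, hc, hT, hT₀T, hc1, hrel, ?_, ?_⟩
  · have h1 := abs_le.1 hE
    have h2 := abs_lt.1 hn₁
    have h3 := abs_le.1 hxE
    exact abs_le.2 ⟨by linarith, by linarith⟩
  · have h1 := abs_le.1 hD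
    have h2 := abs_lt.1 hn₂
    have h3 := abs_le.1 hxD
    exact abs_le.2 ⟨by linarith, by linarith⟩

/-! ### Composition -/

/-- **The line closes the crux BY NAME modulo the five registered stubs** (sorry-free).  Constants `(C, θ)` are
those of stub R.  For an in-scope orbit `u` take R's response measure `m` on the NS phase `(K, φ)` of `NS_{ν/2}(f)`;
N gives an enlarged NS phase `(K', φ')` with a sliced smooth hyperbolic model, D closes in the model and
`hasRelKatokClosing_of_relSmoothModel` lifts the closing to `(K', φ')` modulo symmetry; `m` stays invariant on `K'`
(`IsInvariantMeasure.enlarge`), its Birkhoff limits `(En, D)` exist a.e. (`stub_birkhoffMeans`) and lie STRICTLY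
inside the tolerance window (R; means unchanged by the enlargement); hence some shrunken closed cell
`B_k = {|En − Ē| ≤ t_E − 1/(k+1), |D − Ī| ≤ t_D − 1/(k+1)}` has positive measure; relative closing with budgets at
precision `1/(4(k+1))` and closing time `T ≥ 2(k+1)·max(R,1)` (S, `relClosingWithBudgetWindow`; `R` the drift
bound of the closing) gives a relative periodic point with drift `‖c‖ ≤ R`, and W turns it into the periodic
classical partner `(T, u', p')` at viscosity `ν/2` whose energy exceeds the period mean by the Galilean shift
`‖c/T‖² ≤ 1/(4(k+1))`, inside the window. -/
theorem HalvingCeiling_of :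
    Sig.stub_hyperbolicResponseMeasure → Sig.stub_relSmoothModelOfPhase → Sig.stub_ambientClosing →
      Sig.stub_relShadowBudgets → Sig.stub_relPeriodicWitness → HalvingCeiling := by
  intro hR hN hD hS hW f hf hdiv hmean hshell
  obtain ⟨C, θ, hC, hθ, hθ1, hclause, hresp⟩ := hR f hf hdiv hmean hshell
  refine ⟨C, θ, hC, hθ, hθ1, hclause, ?_⟩
  intro ν τ u p hν hτ hper hsol hEpos hβ hr
  obtain ⟨K, φ, m, hK, hm, hH, hwin⟩ := hresp ν τ u p hν hτ hper hsol hEpos hβ hr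
  have hν2 : 0 < ν / 2 := half_pos hν
  obtain ⟨K', φ', π, U, Λ, g, mm, hKK', hagree, hK', hmodel, hSm⟩ :=
    hN (ν / 2) f K φ m hν2 hf hdiv hmean hK hm hH
  have hm' : IsInvariantMeasure K' φ' m := hm.enlarge hKK' hagree
  have hcl : HasRelKatokClosing (ν / 2) f K' φ' m :=
    hasRelKatokClosing_of_relSmoothModel hK'.isCompact hm' hSm (hD U Λ g mm hmodel)
  obtain ⟨En, D, hEm, hDm, -, -, -, -, -, hlim⟩ := stub_birkhoffMeans hK' hm'
  -- tolerances of the crux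
  set tE : ℝ := C * (ν * meanDissipation ν u / meanEnergy u ^ 2) ^ (θ / 2) * meanEnergy u with htE
  set tD : ℝ := C * (ν * meanDissipation ν u / meanEnergy u ^ 2) ^ (θ / 2) * meanDissipation ν u with htD
  -- the window at the Birkhoff limits, `m`-a.e. (means unchanged by the enlargement on `K`, which carries `m`)
  have hwin' : ∀ᵐ x ∂m, |En x - meanEnergy u| < tE ∧ |D x - meanDissipation ν u| < tD := by
    filter_upwards [hwin, hlim, hm.ae_mem] with x hx hl hxK
    have hEq : energyAvg φ' x =ᶠ[atTop] energyAvg φ x :=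
      (eventually_ge_atTop (0 : ℝ)).mono fun T hT => energyAvg_congr_of_agree hagree hxK hT
    have hDq : dissipAvg (ν / 2) φ' x =ᶠ[atTop] dissipAvg (ν / 2) φ x :=
      (eventually_ge_atTop (0 : ℝ)).mono fun T hT => dissipAvg_congr_of_agree hagree hxK hT
    exact hx (En x) (D x) ((tendsto_congr' hEq).1 hl.1) ((tendsto_congr' hDq).1 hl.2)
  -- shrunken closed cells exhausting the open window
  set B : ℕ → Set Hsp := fun k => {x | |En x - meanEnergy u| ≤ tE - 1 / ((k : ℝ) + 1) ∧
      |D x - meanDissipation ν u| ≤ tD - 1 / ((k : ℝ) + 1)} with hBdef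
  have hBm : ∀ k, MeasurableSet (B k) := fun k =>
    (measurableSet_le (continuous_abs.measurable.comp (hEm.sub measurable_const)) measurable_const).inter
      (measurableSet_le (continuous_abs.measurable.comp (hDm.sub measurable_const)) measurable_const)
  have hcover : ∀ᵐ x ∂m, x ∈ ⋃ k, B k := by
    filter_upwards [hwin'] with x hx
    obtain ⟨h1, h2⟩ := hx
    obtain ⟨k, hk⟩ := exists_nat_one_div_lt (lt_min (sub_pos.2 h1) (sub_pos.2 h2))
    have hk1 := min_le_left (tE - |En x - meanEnergy u|) (tD - |D x - meanDissipation ν u|)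
    have hk2 := min_le_right (tE - |En x - meanEnergy u|) (tD - |D x - meanDissipation ν u|)
    exact mem_iUnion.2 ⟨k, by constructor <;> linarith⟩
  obtain ⟨k, hk⟩ : ∃ k, m (B k) ≠ 0 := by
    by_contra h
    push Not at h
    haveI := hm.prob
    have h1 : m (⋃ k, B k) = 0 := measure_iUnion_null h
    have h2 : m (⋃ k, B k)ᶜ = 0 := ae_iff.1 hcover
    have h3 : m univ ≤ m (⋃ k, B k) + m (⋃ k, B k)ᶜ := by
      rw [← Set.union_compl_self (⋃ k, B k)]; exact measure_union_le _ _
    rw [h1, h2, add_zero, measure_univ] at h3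
    exact one_ne_zero (le_zero_iff.1 h3)
  -- relative closing with budgets at precision `1/(4(k+1))` and closing time `≥ 2(k+1)`, then the witness
  have hkpos : (0 : ℝ) < 1 / ((k : ℝ) + 1) := Nat.one_div_pos_of_nat
  have hk4 : (0 : ℝ) < 1 / (4 * ((k : ℝ) + 1)) := by positivity
  have hq : 4 * (1 / (4 * ((k : ℝ) + 1))) = 1 / ((k : ℝ) + 1) := by
    field_simp
  obtain ⟨R, hwin2⟩ :=
    relClosingWithBudgetWindow hK' hm' hcl (hS (ν / 2) f K' φ' hν2 hf hdiv hmean hK') (hBm k) hk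
      (fun x hx => hx) hlim
  -- closing time `T₀ = 2(k+1)·max(R,1)` makes the Galilean shift `‖c/T‖² ≤ R²/T₀² ≤ 1/(4(k+1))`
  set M : ℝ := max R 1 with hMdef
  have hM0 : 0 < M := lt_max_of_lt_right one_pos
  set T₀ : ℝ := 2 * ((k : ℝ) + 1) * M with hT₀def
  have hT₀pos : 0 < T₀ := by positivity
  obtain ⟨z, hz, T, c, hc, hT, hT₀, hcR, hrel, hEz, hDz⟩ := hwin2 _ hk4 T₀
  obtain ⟨u', p', hsol', hper', hmE, hmD⟩ :=
    hW (ν / 2) f K' φ' z T c hν2 hf hdiv hmean hK' hz hT hc hrel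
  have hk1 : (1 : ℝ) ≤ (k : ℝ) + 1 := by
    have := (Nat.cast_nonneg k : (0 : ℝ) ≤ k); linarith
  have hshift0 : 0 ≤ ‖T⁻¹ • c‖ ^ 2 := sq_nonneg _
  have hshift : ‖T⁻¹ • c‖ ^ 2 ≤ 1 / (4 * ((k : ℝ) + 1)) := by
    have hcM : ‖c‖ ≤ M := hcR.trans (le_max_left _ _)
    have key : 4 * ((k : ℝ) + 1) * ‖c‖ ^ 2 ≤ T ^ 2 :=
      calc 4 * ((k : ℝ) + 1) * ‖c‖ ^ 2 ≤ 4 * ((k : ℝ) + 1) * M ^ 2 :=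
            mul_le_mul_of_nonneg_left (pow_le_pow_left₀ (norm_nonneg c) hcM 2) (by positivity)
        _ ≤ 4 * ((k : ℝ) + 1) ^ 2 * M ^ 2 :=
            mul_le_mul_of_nonneg_right (by nlinarith [hk1]) (sq_nonneg M)
        _ = T₀ ^ 2 := by rw [hT₀def]; ring
        _ ≤ T ^ 2 := pow_le_pow_left₀ hT₀pos.le hT₀ 2
    have hT2 : 0 < T ^ 2 := by positivity
    rw [norm_smul, norm_inv, Real.norm_eq_abs, abs_of_pos hT, mul_pow, inv_pow, one_div,
      inv_mul_le_iff₀ hT2, ← div_eq_mul_inv, le_div_iff₀ (by positivity : (0 : ℝ) < 4 * ((k : ℝ) + 1))]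
    linarith [key]
  refine ⟨T, u', p', hT, hper', hsol', ?_, ?_⟩
  · rw [hmE]
    have h := abs_le.1 hEz
    exact abs_le.2 ⟨by linarith, by linarith⟩
  · rw [hmD]
    have h := abs_le.1 hDz
    exact abs_le.2 ⟨by linarith, by linarith⟩

end Summit.AnomalousDissipation.AnomalousDissipation.Cruxes.HalvingCeiling.KatokClosing

end
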